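import Literature.NumberTheory.Transcendental.ZudilinOddZetaIntegral
import Mathlib.MeasureTheory.Measure.Lebesgue.Integral
import HarnessLib

/-!
# Zudilin's linear forms as half-line integrals: `Sₙ = −π² Im ∫₀^∞ Rₙ(m+½+iy) sinh(πy)/cosh³(πy) dy`

Topic `Literature/NumberTheory/Transcendental`; continues `ZudilinOddZetaIntegral.lean`
(`Literature.NumberTheory.Transcendental.Zudilin2004.S_eq_re_integral`). Everything here is PROVED;
no definitions, no named facts.

`Rₙ` has rational coefficients, so `Rₙ(conj k) = conj Rₙ(k)` (`Zudilin2004.R_conj`), and the kernel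
`sinh(πy)/cosh³(πy)` is odd; hence the Barnes integral over the whole half-integer line is
`J − conj J = 2i Im J` with `J = ∫₀^∞`, and

  `Sₙ = −π² · Im ∫_{y>0} Rₙ(m + ½ + iy) sinh(πy)/cosh³(πy) dy`   (`Zudilin2004.S_eq_neg_pi_sq_mul_im`),

for `n ≥ 1` and any integer `0 ≤ m ≤ 27n`. The half-line integral concentrates at the single
saddle point `κ₀ = 23.479… + 3.328… i` of the upper half-plane (`Zudilin2004.saddle`), which is
why the real quantity `Sₙ` exhibits the two conjugate saddle points of [Zudilin2004, Lemma 20]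
only through `Im`. Folklore manipulations; [cite: Zudilin2004, §8 (8.4)–(8.6), Lemma 20].
-/

noncomputable section

open Complex MeasureTheory Set Filter
open scoped Real ComplexConjugate

namespace Literature.NumberTheory.Transcendental

namespace Zudilin2004

/-- `Rₙ(conj k) = conj Rₙ(k)` (rational coefficients). [cite: Zudilin2004, §8 (8.7)] -/
theorem R_conj (n : ℕ) (k : ℂ) : R n (conj k) = conj (R n k) := by
  unfold R
  simp only [map_mul, map_div₀, map_pow, map_prod, map_add, map_sub, map_natCast, map_ratCast,
    map_ofNat]

/-- The kernel `sinh(πy)/cosh³(πy)` is odd. [folklore] -/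
theorem kernel_neg (y : ℝ) :
    (Real.sinh (π * -y) : ℂ) / (Real.cosh (π * -y) : ℂ) ^ 3 =
      -((Real.sinh (π * y) : ℂ) / (Real.cosh (π * y) : ℂ) ^ 3) := by
  rw [mul_neg, Real.sinh_neg, Real.cosh_neg]; push_cast; ring

/-- The kernel is bounded by `1`: `|sinh(πy)/cosh³(πy)| ≤ 1`. [folklore] -/
theorem norm_kernel_le (y : ℝ) :
    ‖(Real.sinh (π * y) : ℂ) / (Real.cosh (π * y) : ℂ) ^ 3‖ ≤ 1 := by
  have hc : 0 < Real.cosh (π * y) := Real.cosh_pos _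
  rw [norm_div, norm_pow, Complex.norm_real, Complex.norm_real, Real.norm_eq_abs, Real.norm_eq_abs,
    abs_of_pos hc, div_le_one (by positivity)]
  have h1 : |Real.sinh (π * y)| ≤ Real.cosh (π * y) := by
    rw [abs_le]
    have := Real.sinh_lt_cosh (π * y)
    have h2 := Real.sinh_lt_cosh (-(π * y))
    rw [Real.sinh_neg, Real.cosh_neg] at h2
    constructor <;> linarith
  have h3 : 1 ≤ Real.cosh (π * y) := Real.one_le_cosh _
  calc |Real.sinh (π * y)| ≤ Real.cosh (π * y) := h1
    _ = Real.cosh (π * y) ^ 1 := (pow_one _).symm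
    _ ≤ Real.cosh (π * y) ^ 3 := pow_le_pow_right₀ h3 (by norm_num)

/-- The integrand of the Barnes integral along `re k = c ≥ 0` is integrable (`n ≥ 1`). [folklore] -/
theorem integrable_R_mul_kernel {n : ℕ} (hn : 1 ≤ n) {c : ℝ} (hc : 0 ≤ c) :
    Integrable fun y : ℝ ↦ R n ((c : ℂ) + y * I) *
      ((Real.sinh (π * y) : ℂ) / (Real.cosh (π * y) : ℂ) ^ 3) := by
  have hcont : Continuous fun y : ℝ ↦ R n ((c : ℂ) + y * I) *
      ((Real.sinh (π * y) : ℂ) / (Real.cosh (π * y) : ℂ) ^ 3) := by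
    refine Continuous.mul ?_ ?_
    · have hline : Continuous fun y : ℝ ↦ (c : ℂ) + y * I := by fun_prop
      have hmem : ∀ y : ℝ, (c : ℂ) + y * I ∈ {k : ℂ | -1 / 2 < k.re} := fun y ↦ by
        simp; linarith
      exact (differentiableOn_R hn).continuousOn.comp_continuous hline hmem
    · refine Continuous.div (by fun_prop) (by fun_prop) fun y ↦ ?_
      exact pow_ne_zero 3 (by exact_mod_cast (Real.cosh_pos _).ne')
  refine Integrable.mono' ((integrable_inv_one_add_sq.const_mul
    (8 * |(normConst n : ℝ)| * 64 ^ (162 * n + 1)))) hcont.aestronglyMeasurable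
    (Eventually.of_forall fun y ↦ ?_)
  rw [norm_mul]
  have hR := norm_R_le hn (k := (c : ℂ) + y * I) (by simp; linarith)
  have hy : 1 + y ^ 2 ≤ 1 + ‖(c : ℂ) + y * I‖ ^ 2 := by
    have : |y| ≤ ‖(c : ℂ) + y * I‖ := by simpa using abs_im_le_norm ((c : ℂ) + y * I)
    nlinarith [sq_abs y, abs_nonneg y]
  have hC : 0 ≤ 8 * |(normConst n : ℝ)| * 64 ^ (162 * n + 1) := by positivity
  calc ‖R n ((c : ℂ) + y * I)‖ * ‖(Real.sinh (π * y) : ℂ) / (Real.cosh (π * y) : ℂ) ^ 3‖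
      ≤ 8 * |(normConst n : ℝ)| * 64 ^ (162 * n + 1) / (1 + y ^ 2) * 1 :=
        mul_le_mul (hR.trans (div_le_div_of_nonneg_left hC (by positivity) hy)) (norm_kernel_le y)
          (norm_nonneg _) (by positivity)
    _ = 8 * |(normConst n : ℝ)| * 64 ^ (162 * n + 1) * (1 + y ^ 2)⁻¹ := by ring

/-- **Half-line form of Zudilin's linear forms.** For `n ≥ 1` and an integer `0 ≤ m ≤ 27n`,
`Sₙ = −π² · Im ∫_{y > 0} Rₙ(m + ½ + iy) sinh(πy)/cosh³(πy) dy`.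
[cite: Zudilin2004, §8 (8.4)–(8.6) and Lemma 20] -/
theorem S_eq_neg_pi_sq_mul_im {n : ℕ} (hn : 1 ≤ n) {m : ℕ} (hm : m ≤ 27 * n) :
    S n = -π ^ 2 * (∫ y in Ioi (0 : ℝ), R n ((m : ℂ) + 1 / 2 + y * I) *
      ((Real.sinh (π * y) : ℂ) / (Real.cosh (π * y) : ℂ) ^ 3)).im := by
  set c : ℝ := (m : ℝ) + 1 / 2 with hc
  have hc0 : 0 ≤ c := by rw [hc]; positivity
  set g : ℝ → ℂ := fun y ↦ R n ((c : ℂ) + y * I) *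
    ((Real.sinh (π * y) : ℂ) / (Real.cosh (π * y) : ℂ) ^ 3) with hg
  have hint : Integrable g := integrable_R_mul_kernel hn hc0
  have hcast : ((m : ℂ) + 1 / 2) = (c : ℂ) := by rw [hc]; push_cast; ring
  rw [S_eq_re_integral hn hm]
  simp_rw [hcast]
  change ((I * π ^ 2 / 2) * ∫ y : ℝ, g y).re = -π ^ 2 * (∫ y in Ioi (0 : ℝ), g y).im
  -- split the line at `0` and fold the lower half onto the upper half
  have hsplit := intervalIntegral.integral_Iic_add_Ioi (b := (0 : ℝ)) hint.integrableOn hint.integrableOn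
  have hlower : ∫ y in Iic (0 : ℝ), g y = -conj (∫ y in Ioi (0 : ℝ), g y) := by
    have h1 : ∫ y in Iic (0 : ℝ), g y = ∫ y in Ioi (0 : ℝ), g (-y) := by
      rw [integral_comp_neg_Ioi]; simp
    rw [h1, ← integral_conj, ← integral_neg]
    refine setIntegral_congr_fun measurableSet_Ioi fun y _ ↦ ?_
    simp only [hg]
    have hk : (c : ℂ) + ((-y : ℝ) : ℂ) * I = conj ((c : ℂ) + y * I) := by
      apply Complex.ext <;> simp
    rw [hk, R_conj, kernel_neg, map_mul, map_div₀, map_pow, Complex.conj_ofReal, Complex.conj_ofReal]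
    ring
  rw [← hsplit, hlower]
  -- `Re((iπ²/2)(J - conj J)) = -π² Im J`
  set J := ∫ y in Ioi (0 : ℝ), g y
  have hJ : -conj J + J = ((2 * J.im : ℝ) : ℂ) * I := by
    apply Complex.ext <;> simp; ring
  rw [hJ]
  have : (I * (π : ℂ) ^ 2 / 2 * (((2 * J.im : ℝ) : ℂ) * I)) = ((-(π ^ 2 * J.im) : ℝ) : ℂ) := by
    push_cast
    ring_nf
    rw [Complex.I_sq]
    ring
  rw [this, Complex.ofReal_re]
  ring

end Zudilin2004

end Literature.NumberTheory.Transcendental
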